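import Mathlib
import HarnessLib
import Summits.HubbardSuperconductivity.HubbardSuperconductivity.Theorems.KLProgrammeKLRegimeTwoVolumeDefectStep
import Summits.HubbardSuperconductivity.HubbardSuperconductivity.Theorems.KLProgrammeKLRegimeTwoVolumeBlockDefect
import Summits.HubbardSuperconductivity.HubbardSuperconductivity.Theorems.KLProgrammeKLRegimeTwoVolumeBlockDefectGram
import Literature.MathematicalPhysics.QuantumLattice.GrassmannEffectiveActionCopies

/-!
# Route `KLProgramme` — crux K3, the nested two-volume pass (β′): THE BLOCK-DEFECT STEP ASSEMBLED — k3c5-p2's defect step (p515439) with its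
# covariance side DISCHARGED from the block structure (cell gate-hubbard-kl, seat hubbard-kl-k3c4-p1 g7)

`sum_norm_kernel_twoVolumeDefect_le` (k3c5-p2, `…TwoVolumeDefectStep`) bounds the pinned kernel difference of `effAction (C + Dn + Df) V` and
`effAction C V` on ONE algebra from data of `Dn`, `Df` and of the intermediate actions.  Here it is COMPOSED with this seat's covariance-side files
(`GrassmannEffectiveActionCopies` p517514, `…TwoVolumeBlockDefect` p518724, `…TwoVolumeBlockDefectGram` p518931) into ONE theorem for the nested
two-volume comparison on a block structure `e : Γ′ ≃ ι × Γ` (torus `bL` ⊃ `b²` boxes `≅` torus `L`):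

**`sum_norm_kernel_sub_copies_le`** — for the coarse covariance `C` and interaction `V` (even, no constant part, `Z(C,V)` a unit), the fine
covariance `C′`, the copies/near/far matrices `C^cop, Dn, Df` (given by their entries), and
  (P)  periodisation `Σ_{πY″ = Y} C′ X′ Y″ = C (πX′) Y`,  (G1)/(G2) the torus geometry of the zone `Zs` and a separation `Far`,  a row tail `T` of `C′` on `Far`,
  antisymmetry of `C, C′`, sup/row bounds `s, α` / `s′, α′`, charge selection and charged Gram forms `(f, g, κ)` / `(f′, g′, κ′)` with `√(κ′² + κ²) ≤ κ_D`,
  a distance `d ≥ R_f` on the zone (pin `w`),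
  the COARSE all-degree pinned profile `N` of `effAction C V` (it IS the profile of the decoupled fine action, `sum_pinned_kernel_copies_sum`) with the far
  smallness, and the near/far kernel data of `𝒱_s := effAction (s•Df) W^dec`, `W₁ := effAction Df W^dec` (`W^dec := effAction C^cop (Σ_β V∘f_β)`),
at a pin `w`, in every degree `n + 1`:
`Σ_{X : X_p = w} ‖kernel (effAction C′ (Σ_β V∘f_β)) (n+1) X − kernel (Σ_β (effAction C V)∘f_β) (n+1) X‖ ≤ NEAR(αn = 2T, sn = T, κn = √(2)κ_D) + FAR(s′+s, α′+α, κ_D, R_f)`.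

By `kernel_copies_sum` the subtracted kernel is the COARSE kernel at the projected legs (zero unless all legs share a block): this is the nested
two-volume comparison «fine action vs coarse action» at any pin, with everything two-volume-specific discharged; what the caller supplies is ONE-volume
data (decay numbers and Gram forms of the two covariances, the coarse profile) plus the single-scale kernel data of `𝒱_s`, `W₁` on the fine algebra.
Sorry-free; no definition.  References: BETA-PRIME-ROADMAP.md (k3c5-p2 g5) §0–§2; BGM 2006 (2.13)–(2.14), (2.80); Salmhofer 1999 (2.102)–(2.106).
-/

noncomputable section

namespace Summit.HubbardSuperconductivity.HubbardSuperconductivity.Theorems.TwoVolumeDefect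

set_option linter.dupNamespace false -- summit = problem name (single-conjunct summit), D-0017

open Finset Literature.MathematicalPhysics.QuantumLattice GrassmannAlgebra Literature.Probability.LatticeModels
open scoped Nat InnerProductSpace

variable {𝕜 : Type*} [RCLike 𝕜]

/-- **THE BLOCK-DEFECT STEP, ASSEMBLED** (see the module docstring for the reading of the hypotheses; the conclusion is
`sum_norm_kernel_twoVolumeDefect_le`'s with `αn := 2T`, `sn := T`, `κn := √(κ_D² + κ_D²)`, `sD := s′ + s`, `αf := α′ + α`, `κf := κ_D`, `R := R_f`).
[folklore; BGM 2006 (2.13)–(2.14), (2.80); Salmhofer 1999 (2.102)–(2.106)] -/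
theorem sum_norm_kernel_sub_copies_le {Γ ι : Type*} [Fintype Γ] [DecidableEq Γ] [Fintype ι] [DecidableEq ι]
    {Γ' : Type} [LinearOrder Γ'] [Fintype Γ']
    {E E' : Type*} [NormedAddCommGroup E] [InnerProductSpace 𝕜 E] [NormedAddCommGroup E'] [InnerProductSpace 𝕜 E']
    (e : Γ' ≃ ι × Γ) (C : Matrix Γ Γ 𝕜) (C' Ccop Dn Df : Matrix Γ' Γ' 𝕜) (Zs : Set Γ') [DecidablePred (· ∈ Zs)]
    (hCcop : ∀ X' Y', Ccop X' Y' = if (e X').1 = (e Y').1 then C (e X').2 (e Y').2 else 0)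
    (hDf : ∀ X' Y', Df X' Y' = if X' ∈ Zs ∧ Y' ∈ Zs then C' X' Y' - Ccop X' Y' else 0)
    (hDn : ∀ X' Y', Dn X' Y' = if X' ∈ Zs ∧ Y' ∈ Zs then 0 else C' X' Y' - Ccop X' Y')
    -- (P) periodisation, (G1)/(G2) geometry, row tail
    (hP : ∀ (X' : Γ') (Y : Γ), ∑ Y'' ∈ univ.filter (fun Y'' : Γ' => (e Y'').2 = Y), C' X' Y'' = C (e X').2 Y)
    (Far : Γ' → Γ' → Prop) [∀ X' Y', Decidable (Far X' Y')]
    (hG1 : ∀ X' Y', (e X').1 ≠ (e Y').1 → ¬ (X' ∈ Zs ∧ Y' ∈ Zs) → Far X' Y')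
    (hG2 : ∀ X' Y' Y'', (e X').1 = (e Y').1 → (e Y'').2 = (e Y').2 → Y'' ≠ Y' → ¬ (X' ∈ Zs ∧ Y' ∈ Zs) → Far X' Y'')
    {T : ℝ} (hT0 : 0 < T) (hT : ∀ X', ∑ Y' ∈ univ.filter (fun Y' : Γ' => Far X' Y'), ‖C' X' Y'‖ ≤ T)
    -- antisymmetry and sizes of `C`, `C′`
    (hCt : ∀ X Y, C Y X = -C X Y) (hC't : ∀ X' Y', C' Y' X' = -C' X' Y')
    {s s' : ℝ} (hs0 : 0 ≤ s) (hs'0 : 0 ≤ s') (hs : ∀ X Y, ‖C X Y‖ ≤ s) (hs' : ∀ X' Y', ‖C' X' Y'‖ ≤ s')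
    {α α' : ℝ} (hαα : 0 < α' + α) (hrow : ∀ X, ∑ Y, ‖C X Y‖ ≤ α) (hrow' : ∀ X', ∑ Y', ‖C' X' Y'‖ ≤ α')
    -- charges and charged Gram forms
    (q : Γ → Bool) (hCq : ∀ X Y, q X = q Y → C X Y = 0) (hC'q : ∀ X' Y', q (e X').2 = q (e Y').2 → C' X' Y' = 0)
    (f g : Γ → E) (f' g' : Γ' → E') {κ κ' κD : ℝ} (hκD0 : 0 < κD) (hκD : Real.sqrt (κ' ^ 2 + κ ^ 2) ≤ κD)
    (hf : ∀ X, q X = true → ‖f X‖ ≤ κ) (hg : ∀ Y, q Y = false → ‖g Y‖ ≤ κ)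
    (hf' : ∀ X', q (e X').2 = true → ‖f' X'‖ ≤ κ') (hg' : ∀ Y', q (e Y').2 = false → ‖g' Y'‖ ≤ κ')
    (hG : ∀ X Y, q X = true → q Y = false → contr 𝕜 C X Y = ⟪f X, g Y⟫_𝕜)
    (hG' : ∀ X' Y', q (e X').2 = true → q (e Y').2 = false → contr 𝕜 C' X' Y' = ⟪f' X', g' Y'⟫_𝕜)
    -- the far distance and the pin
    (d : Γ' → ℝ) (hd0 : ∀ X, 0 ≤ d X) {Rf : ℝ} (hRf : 0 < Rf) (hdR : ∀ X, X ∈ Zs → Rf ≤ d X) (w : Γ')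
    -- the coarse interaction and the block embeddings
    (Fe : ι → (Γ → 𝕜) →ₗ[𝕜] (Γ' → 𝕜)) (hFe : ∀ β v X', Fe β v X' = if (e X').1 = β then v (e X').2 else 0)
    {V : GrassmannAlgebra 𝕜 Γ} (hVe : V ∈ evenOdd 𝕜 0) (hV0 : constPart 𝕜 V = 0) (hZ : IsUnit (effPartitionFn 𝕜 C V))
    -- the coarse all-degree profile and the far smallness
    (N : ℕ → ℝ) (hN0 : ∀ m, 0 ≤ N m)
    (hN : ∀ (m : ℕ) (j : Fin m) (x : Γ), ∑ X ∈ univ.filter (fun X : Fin m → Γ => X j = x), ‖kernel 𝕜 (effAction 𝕜 C V) m X‖ ≤ N m)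
    {ρf : ℝ} (hρf : 0 < ρf) (hθf : Real.exp 1 * (α' + α) * normV Γ' κD ρf (fun m' => N (2 * m')) / κD ^ 2 < 1)
    -- uniform-in-`s` kernel data of `𝒱_s := effAction (s•Df) W^dec`
    (nV mV mL : ℕ → ℝ) (hnV : ∀ m, 0 ≤ nV m) (hmV : ∀ m, 0 ≤ mV m)
    (hVs0 : ∀ s ∈ Set.Icc (0 : ℝ) 1, ∀ (m : ℕ) (x : Γ'),
      ∑ U ∈ univ.filter (fun U : Fin (m + 1) → Γ' => U 0 = x),
        ‖kernel 𝕜 (effAction 𝕜 (s • Df) (effAction 𝕜 Ccop (∑ β, ExteriorAlgebra.map (Fe β) V))) (m + 1) U‖ ≤ nV (m + 1))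
    (hVsm : ∀ s ∈ Set.Icc (0 : ℝ) 1, ∀ (m : ℕ) (i : Fin m),
      ∑ U ∈ univ.filter (fun U : Fin (m + 1) → Γ' => U i.succ = w),
        d (U 0) * ‖kernel 𝕜 (effAction 𝕜 (s • Df) (effAction 𝕜 Ccop (∑ β, ExteriorAlgebra.map (Fe β) V))) (m + 1) U‖ ≤ mV (m + 1))
    (n : ℕ) (p : Fin (n + 1))
    (hVsL : ∀ s ∈ Set.Icc (0 : ℝ) 1,
      ∑ Z ∈ univ.filter (fun Z : Fin (n + 1 + 1 + 1) → Γ' => Z (Fin.castSucc (Fin.castSucc p)) = w),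
        d (Z (Fin.last (n + 1 + 1))) *
          ‖kernel 𝕜 (effAction 𝕜 (s • Df) (effAction 𝕜 Ccop (∑ β, ExteriorAlgebra.map (Fe β) V))) (n + 1 + 2) Z‖ ≤ mL (n + 3))
    -- all-degree profile of `W₁ := effAction Df W^dec` and the near smallness
    (Nn : ℕ → ℝ) (hNn0 : ∀ m, 0 ≤ Nn m)
    (hNn : ∀ (m : ℕ) (j : Fin m) (x : Γ'), ∑ Z ∈ univ.filter (fun Z : Fin m → Γ' => Z j = x),
      ‖kernel 𝕜 (effAction 𝕜 Df (effAction 𝕜 Ccop (∑ β, ExteriorAlgebra.map (Fe β) V))) m Z‖ ≤ Nn m)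
    {ρn : ℝ} (hρn : 0 < ρn)
    (hθn : Real.exp 1 * (2 * T) * normV Γ' (Real.sqrt (κD ^ 2 + κD ^ 2)) ρn (fun m' => Nn (2 * m')) /
      Real.sqrt (κD ^ 2 + κD ^ 2) ^ 2 < 1)
    {k : ℕ} (hk : grassmannLaplacian 𝕜 Dn ^ k = 0) :
    ∑ X ∈ univ.filter (fun X : Fin (n + 1) → Γ' => X p = w),
        ‖kernel 𝕜 (effAction 𝕜 C' (∑ β, ExteriorAlgebra.map (Fe β) V)) (n + 1) X -
          kernel 𝕜 (∑ β, ExteriorAlgebra.map (Fe β) (effAction 𝕜 C V)) (n + 1) X‖ ≤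
      (∑ j ∈ Ico 1 k, ((n + 1 + 2 * j)! : ℝ) / (((n + 1) ! : ℝ) * (j ! : ℝ) * 2 ^ j) * T ^ j * Nn (n + 1 + 2 * j) +
          ρn⁻¹ ^ (n + 1) * (Real.exp 1 * normV Γ' (Real.sqrt (κD ^ 2 + κD ^ 2)) ρn (fun m' => Nn (2 * m'))) *
            (Real.exp 1 * (2 * T) * normV Γ' (Real.sqrt (κD ^ 2 + κD ^ 2)) ρn (fun m' => Nn (2 * m')) /
                Real.sqrt (κD ^ 2 + κD ^ 2) ^ 2) /
              (1 - Real.exp 1 * (2 * T) * normV Γ' (Real.sqrt (κD ^ 2 + κD ^ 2)) ρn (fun m' => Nn (2 * m')) /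
                Real.sqrt (κD ^ 2 + κD ^ 2) ^ 2)) +
        ((((n + 1 + 1) * (n + 1 + 2) : ℕ) : ℝ) / 2 * ((s' + s) / Rf) * mL (n + 3) +
          ‖(2 : 𝕜)⁻¹‖ * ∑ a ∈ range (n + 2), ∑ b ∈ range (n + 2),
            (if a + b = n + 1 then (((a + 1) * (b + 1) : ℕ) : ℝ) *
              ((α' + α) * (mV (a + 1) / Rf) * nV (b + 1) + (α' + α) * nV (a + 1) * (mV (b + 1) / Rf)) else 0)) := by
  classical
  -- the decoupled reference: `effAction C^cop (Σ_β V∘f_β) = Σ_β (effAction C V)∘f_β`, unit partition function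
  obtain ⟨hZ', hA'⟩ := effAction_copies_sum e C Ccop hCcop Fe hFe hVe hV0 hZ (univ : Finset ι)
  have hdec : C' = Ccop + Dn + Df := (copies_add_near_add_far C' Ccop Dn Df Zs hDf hDn).symm
  rw [hdec, ← hA']
  -- parity / constant part of the glued interaction
  have hV'e : (∑ β, ExteriorAlgebra.map (Fe β) V) ∈ evenPart 𝕜 Γ' :=
    (mem_evenPart_iff).2 (Submodule.sum_mem _ fun β _ => map_blockEmb_mem_evenOdd_zero hVe)
  have hV'0 : constPart 𝕜 (∑ β, ExteriorAlgebra.map (Fe β) V) = 0 := by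
    rw [map_sum]; exact sum_eq_zero fun β _ => by rw [constPart_map, hV0]
  -- column sums from row sums (antisymmetry)
  have hcol : ∀ Y, ∑ X, ‖C X Y‖ ≤ α := fun Y => by
    have h : ∀ X, ‖C X Y‖ = ‖C Y X‖ := fun X => by rw [hCt Y X, norm_neg]
    simp_rw [h]; exact hrow Y
  have hcol' : ∀ Y', ∑ X', ‖C' X' Y'‖ ≤ α' := fun Y' => by
    have h : ∀ X', ‖C' X' Y'‖ = ‖C' Y' X'‖ := fun X' => by rw [hC't Y' X', norm_neg]
    simp_rw [h]; exact hrow' Y'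
  -- the charged Gram form of `D = C′ − C^cop` and its norms
  have hκ'D : ∀ X', q (e X').2 = true →
      ‖(WithLp.toLp 2 (f' X', (WithLp.toLp 2 (Pi.single (e X').1 (f (e X').2)) : PiLp 2 (fun _ : ι => E))) :
        WithLp 2 (E' × PiLp 2 (fun _ : ι => E)))‖ ≤ κD :=
    fun X' hX => (norm_gramD_fst_le e f f' X' (hf' X' hX) (hf _ hX)).trans hκD
  have hκ'Dg : ∀ Y', q (e Y').2 = false →
      ‖(WithLp.toLp 2 (g' Y', -(WithLp.toLp 2 (Pi.single (e Y').1 (g (e Y').2)) : PiLp 2 (fun _ : ι => E))) :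
        WithLp 2 (E' × PiLp 2 (fun _ : ι => E)))‖ ≤ κD :=
    fun Y' hY => (norm_gramD_snd_le e g g' Y' (hg' Y' hY) (hg _ hY)).trans hκD
  have hFG := contr_sub_copies_eq_inner e q C C' Ccop hCcop f g f' g' hG hG'
  -- charge selection of the pieces
  have hqf : ∀ X Y, (fun X' => q (e X').2) X = (fun X' => q (e X').2) Y → Df X Y = 0 :=
    fun X Y h => (far_near_apply_of_charge_eq e q C C' Ccop Dn Df Zs hCcop hDf hDn hCq hC'q X Y h).1
  have hqn : ∀ X Y, q (e X).2 = q (e Y).2 → Dn X Y = 0 :=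
    fun X Y h => (far_near_apply_of_charge_eq e q C C' Ccop Dn Df Zs hCcop hDf hDn hCq hC'q X Y h).2
  -- the profile of the decoupled action is the coarse profile
  have hNf : ∀ (m' : ℕ) (j : Fin (2 * m')) (x : Γ'),
      ∑ Y ∈ univ.filter (fun Y : Fin (2 * m') → Γ' => Y j = x),
        ‖kernel 𝕜 (effAction 𝕜 Ccop (∑ β, ExteriorAlgebra.map (Fe β) V)) (2 * m') Y‖ ≤ N (2 * m') := by
    intro m' j x
    rw [hA', sum_pinned_kernel_copies_sum e Fe hFe (effAction 𝕜 C V) j x (fun _ r => ‖r‖) (fun _ => norm_zero)]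
    exact hN _ j _
  refine sum_norm_kernel_twoVolumeDefect_le Ccop Dn Df _ hV'e hV'0 hZ' (fun X' => q (e X').2) hqf
    (fun X' => if X' ∈ Zs then (WithLp.toLp 2 (f' X', (WithLp.toLp 2 (Pi.single (e X').1 (f (e X').2)) : PiLp 2 (fun _ : ι => E))) :
        WithLp 2 (E' × PiLp 2 (fun _ : ι => E))) else 0)
    (fun Y' => if Y' ∈ Zs then (WithLp.toLp 2 (g' Y', -(WithLp.toLp 2 (Pi.single (e Y').1 (g (e Y').2)) : PiLp 2 (fun _ : ι => E))) :
        WithLp 2 (E' × PiLp 2 (fun _ : ι => E))) else 0)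
    hκD0
    (fun X' hX => norm_ite_mem_le Zs
      (fun X' => (WithLp.toLp 2 (f' X', (WithLp.toLp 2 (Pi.single (e X').1 (f (e X').2)) : PiLp 2 (fun _ : ι => E))) :
        WithLp 2 (E' × PiLp 2 (fun _ : ι => E)))) X' hκD0.le (hκ'D X' hX))
    (fun Y' hY => norm_ite_mem_le Zs
      (fun Y' => (WithLp.toLp 2 (g' Y', -(WithLp.toLp 2 (Pi.single (e Y').1 (g (e Y').2)) : PiLp 2 (fun _ : ι => E))) :
        WithLp 2 (E' × PiLp 2 (fun _ : ι => E)))) Y' hκD0.le (hκ'Dg Y' hY))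
    (fun X' Y' hX hY => contr_far_eq_inner_of_form C' Ccop Df Zs hDf
      (fun X' => (WithLp.toLp 2 (f' X', (WithLp.toLp 2 (Pi.single (e X').1 (f (e X').2)) : PiLp 2 (fun _ : ι => E))) :
        WithLp 2 (E' × PiLp 2 (fun _ : ι => E))))
      (fun Y' => (WithLp.toLp 2 (g' Y', -(WithLp.toLp 2 (Pi.single (e Y').1 (g (e Y').2)) : PiLp 2 (fun _ : ι => E))) :
        WithLp 2 (E' × PiLp 2 (fun _ : ι => E)))) (hFG X' Y' hX hY))
    (fun X' Y' h => far_apply_of_not C' Ccop Df Zs hDf h) (by positivity)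
    (fun X' Y' => norm_far_le e C C' Ccop Df Zs hCcop hDf hs'0 hs0 hs' hs X' Y') hαα
    (fun X' => sum_norm_far_row_le e C C' Ccop Df Zs hCcop hDf hrow' hrow X')
    (fun Y' => sum_norm_far_col_le e C C' Ccop Df Zs hCcop hDf hcol' hcol Y')
    d hd0 hRf hdR w (fun m' => N (2 * m')) (fun m' => hN0 _) hNf hρf hθf nV mV mL hnV hmV hVs0 hVsm n p hVsL
    (by positivity)
    (isGramBoundedR_near_of_form e q C' Ccop Dn Zs hDn hqn _ _ hκD0.le hκ'D hκ'Dg hFG)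
    (by positivity)
    (fun X' => sum_norm_near_row_le e C C' Ccop Dn Zs hCcop hDn hP Far hG1 hG2 hT X')
    (fun Y' => sum_norm_near_col_le e C C' Ccop Dn Zs hCcop hDn hP hC't hCt Far hG1 hG2 hT Y')
    (fun X' Y' => norm_near_le e C C' Ccop Dn Zs hCcop hDn hP Far hG1 hG2 hT X' Y')
    Nn hNn0 hNn hρn hθn hk

end Summit.HubbardSuperconductivity.HubbardSuperconductivity.Theorems.TwoVolumeDefect

end
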